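import Mathlib

/-!
# Route `AnisotropyChord` / H0 rotor rung, route (1): the ABSTRACT INDUCTION of THEOREM T (real-sequence bookkeeping)
(prover seat `hubbard-h0-rotor-p1` g13; theory seat `hubbard-h0-rotor-theory-1` THEOREM-T.md §«PROOF (induction on j)»)

Sequences indexed by the sector `i = 0, 1, …, k`: `f i = ⟨S⃗²⟩_{ψ_i}`, `N i = ‖S⁺ψ_i‖² = f i − i² − i`, `Nt i = ‖S⁻ψ_i‖² ≤ V²`,
`ep i` = the ladder excess `⟨S⁺ψ_i, H S⁺ψ_i⟩ − E(i)‖S⁺ψ_i‖²`.  Inputs (all proved elsewhere from LEMMA E, the variational floor,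
(H3) and the one-link Temple step): `ep 0 ≤ 4ηV`, `ep i ≤ 4ηV + (ep(i−1)/N(i−1))·Nt i`, and the link inequality
`f(i+1) ≥ f i − (L/c₁)(ep i + N i Σ_{m<i} ep m/N m)`.  Output: `f i ≥ f 0 − iθV²` and `ep i ≤ C_i V` for all `i ≤ k`, as soon
as the floor `f 0 − iθV² − i² − i ≥ νV²` and the largeness `L·V·D_i ≤ c₁θV²` hold (`C`, `D` explicit: `cSeq`, `dSeq`).
Pure real analysis; no physics.
-/

set_option linter.dupNamespace false
set_option autoImplicit false

open Finset

namespace Summit.HubbardSuperconductivity.HubbardSuperconductivity.Theorems.AnisotropyChord.Transfer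

/-- the excess constants `C₀ = 4η`, `C_{i+1} = 4η + C_i/ν`. [folklore] -/
noncomputable def cSeq (η ν : ℝ) : ℕ → ℝ
  | 0 => 4 * η
  | i + 1 => 4 * η + cSeq η ν i / ν

/-- the loss constants `D_i = C_i + (Σ_{m<i} C_m)/ν`. [folklore] -/
noncomputable def dSeq (η ν : ℝ) (i : ℕ) : ℝ := cSeq η ν i + (∑ m ∈ range i, cSeq η ν m) / ν

/-- `C_i ≥ 0`. [folklore] -/
theorem cSeq_nonneg {η ν : ℝ} (hη : 0 ≤ η) (hν : 0 < ν) : ∀ i, 0 ≤ cSeq η ν i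
  | 0 => by simp [cSeq]; linarith
  | i + 1 => by
    simp only [cSeq]
    have := cSeq_nonneg hη hν i
    positivity

/-- `D_i ≥ 0`. [folklore] -/
theorem dSeq_nonneg {η ν : ℝ} (hη : 0 ≤ η) (hν : 0 < ν) (i : ℕ) : 0 ≤ dSeq η ν i := by
  unfold dSeq
  have h1 := cSeq_nonneg hη hν i
  have h2 : 0 ≤ ∑ m ∈ range i, cSeq η ν m := Finset.sum_nonneg fun m _ => cSeq_nonneg hη hν m
  positivity

/-- **THE ABSTRACT INDUCTION of THEOREM T.**  See the module docstring. [conjecture: theory seat hubbard-h0-rotor-theory-1,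
cycle 12, THEOREM-T.md — induction step; Lean proof here] -/
theorem abstract_chain (k : ℕ) {η ν c₁ θ V Lr : ℝ} (hη : 0 ≤ η) (hν : 0 < ν) (hc₁ : 0 < c₁) (hθ : 0 < θ) (hV : 0 < V)
    (hLr : 0 ≤ Lr) (f N Nt ep : ℕ → ℝ)
    (hNdef : ∀ i, i ≤ k → N i = f i - (i : ℝ) ^ 2 - i)
    (hNt : ∀ i, i ≤ k → Nt i ≤ V ^ 2) (hNt0 : ∀ i, i ≤ k → 0 ≤ Nt i) (hNle : ∀ i, i ≤ k → N i ≤ V ^ 2)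
    (hep0 : ep 0 ≤ 4 * η * V)
    (hep : ∀ i, 1 ≤ i → i ≤ k → 0 < N (i - 1) → ep i ≤ 4 * η * V + ep (i - 1) / N (i - 1) * Nt i)
    (hlink : ∀ i, i < k → (∀ m, m ≤ i → 0 < N m) →
      f i - Lr / c₁ * (ep i + N i * ∑ m ∈ range i, ep m / N m) ≤ f (i + 1))
    (hfloor : ∀ i, i ≤ k → ν * V ^ 2 ≤ f 0 - (i : ℝ) * θ * V ^ 2 - (i : ℝ) ^ 2 - i)
    (hL : ∀ i, i ≤ k → Lr * V * dSeq η ν i ≤ c₁ * θ * V ^ 2) :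
    ∀ i, i ≤ k → f 0 - (i : ℝ) * θ * V ^ 2 ≤ f i ∧ ep i ≤ cSeq η ν i * V := by
  -- strong form: all m ≤ i at once
  suffices H : ∀ i, i ≤ k → ∀ m, m ≤ i → f 0 - (m : ℝ) * θ * V ^ 2 ≤ f m ∧ ep m ≤ cSeq η ν m * V from
    fun i hi => H i hi i le_rfl
  intro i
  induction i with
  | zero =>
    intro _ m hm
    have hm0 : m = 0 := Nat.le_zero.mp hm
    subst hm0
    refine ⟨by simp, ?_⟩
    simpa [cSeq] using hep0
  | succ i ih =>
    intro hik m hm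
    have ih' := ih (by omega)
    rcases Nat.lt_or_ge m (i + 1) with hlt | hge
    · exact ih' m (by omega)
    have hmeq : m = i + 1 := le_antisymm hm hge
    subst hmeq
    -- lower bounds N m' ≥ ν V² for m' ≤ i
    have hNlow : ∀ m', m' ≤ i → ν * V ^ 2 ≤ N m' := by
      intro m' hm'
      have h1 := (ih' m' hm').1
      have h2 := hfloor m' (by omega)
      rw [hNdef m' (by omega)]
      linarith
    have hνV : 0 < ν * V ^ 2 := by positivity
    have hNpos : ∀ m', m' ≤ i → 0 < N m' := fun m' hm' => lt_of_lt_of_le hνV (hNlow m' hm')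
    -- the ratio bounds ep m'/N m' ≤ C_{m'} V/(ν V²)
    have hratio : ∀ m', m' ≤ i → ep m' / N m' ≤ cSeq η ν m' * V / (ν * V ^ 2) := by
      intro m' hm'
      have hC := (ih' m' hm').2
      have hNp := hNpos m' hm'
      have hCnn : 0 ≤ cSeq η ν m' * V := mul_nonneg (cSeq_nonneg hη hν m') hV.le
      calc ep m' / N m' ≤ cSeq η ν m' * V / N m' := div_le_div_of_nonneg_right hC hNp.le
        _ ≤ cSeq η ν m' * V / (ν * V ^ 2) := div_le_div_of_nonneg_left hCnn hνV (hNlow m' hm')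
    constructor
    · -- the link i → i+1
      have hl := hlink i (by omega) hNpos
      have hfi := (ih' i le_rfl).1
      have hepi := (ih' i le_rfl).2
      -- Σ_{m<i} ep m / N m ≤ (Σ C_m) V/(ν V²)
      have hsum : ∑ m ∈ range i, ep m / N m ≤ (∑ m ∈ range i, cSeq η ν m) * V / (ν * V ^ 2) := by
        rw [Finset.sum_mul, Finset.sum_div]
        exact Finset.sum_le_sum fun m hm => hratio m (by have := mem_range.mp hm; omega)
      have hNi := hNle i (by omega)
      have hNi0 : 0 ≤ N i := (hNpos i le_rfl).le
      have hloss : ep i + N i * ∑ m ∈ range i, ep m / N m ≤ V * dSeq η ν i := by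
        have hSnn : 0 ≤ (∑ m ∈ range i, cSeq η ν m) * V / (ν * V ^ 2) := by
          apply div_nonneg _ hνV.le
          exact mul_nonneg (Finset.sum_nonneg fun m _ => cSeq_nonneg hη hν m) hV.le
        have h1 : N i * ∑ m ∈ range i, ep m / N m ≤ V ^ 2 * ((∑ m ∈ range i, cSeq η ν m) * V / (ν * V ^ 2)) :=
          calc N i * ∑ m ∈ range i, ep m / N m ≤ N i * ((∑ m ∈ range i, cSeq η ν m) * V / (ν * V ^ 2)) :=
                mul_le_mul_of_nonneg_left hsum hNi0
            _ ≤ V ^ 2 * ((∑ m ∈ range i, cSeq η ν m) * V / (ν * V ^ 2)) := mul_le_mul_of_nonneg_right hNi hSnn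
        have e : V ^ 2 * ((∑ m ∈ range i, cSeq η ν m) * V / (ν * V ^ 2)) = V * ((∑ m ∈ range i, cSeq η ν m) / ν) := by
          field_simp
        unfold dSeq
        rw [e] at h1
        nlinarith [h1, hepi]
      have hLc : 0 ≤ Lr / c₁ := div_nonneg hLr hc₁.le
      have h2 : Lr / c₁ * (ep i + N i * ∑ m ∈ range i, ep m / N m) ≤ θ * V ^ 2 := by
        calc Lr / c₁ * (ep i + N i * ∑ m ∈ range i, ep m / N m) ≤ Lr / c₁ * (V * dSeq η ν i) :=
              mul_le_mul_of_nonneg_left hloss hLc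
          _ = (Lr * V * dSeq η ν i) / c₁ := by ring
          _ ≤ (c₁ * θ * V ^ 2) / c₁ := div_le_div_of_nonneg_right (hL i (by omega)) hc₁.le
          _ = θ * V ^ 2 := by field_simp
      push_cast
      linarith
    · -- the excess at i+1
      have he := hep (i + 1) (by omega) hik (by simpa using hNpos i le_rfl)
      simp only [Nat.add_sub_cancel] at he
      have hr := hratio i le_rfl
      have hNt1 := hNt (i + 1) hik
      have hNt10 := hNt0 (i + 1) hik
      have hCV : 0 ≤ cSeq η ν i * V / (ν * V ^ 2) := div_nonneg (mul_nonneg (cSeq_nonneg hη hν i) hV.le) hνV.le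
      have h1 : ep i / N i * Nt (i + 1) ≤ cSeq η ν i * V / (ν * V ^ 2) * V ^ 2 :=
        calc ep i / N i * Nt (i + 1) ≤ cSeq η ν i * V / (ν * V ^ 2) * Nt (i + 1) :=
              mul_le_mul_of_nonneg_right hr hNt10
          _ ≤ cSeq η ν i * V / (ν * V ^ 2) * V ^ 2 := mul_le_mul_of_nonneg_left hNt1 hCV
      have e : cSeq η ν i * V / (ν * V ^ 2) * V ^ 2 = cSeq η ν i / ν * V := by field_simp
      rw [e] at h1
      show ep (i + 1) ≤ cSeq η ν (i + 1) * V
      simp only [cSeq]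
      nlinarith [he, h1]

end Summit.HubbardSuperconductivity.HubbardSuperconductivity.Theorems.AnisotropyChord.Transfer
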